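import Literature.MathematicalPhysics.QuantumFieldTheory.Balaban1983to89.B1Eq324BenfattoEq324Signed
import Literature.MathematicalPhysics.QuantumFieldTheory.Balaban1983to89.B1Eq324CumulantTaylor
import Literature.MathematicalPhysics.QuantumFieldTheory.Balaban1983to89.B1Eq324BenfattoKernelCondField
import Literature.MathematicalPhysics.QuantumFieldTheory.Balaban1983to89.B1Eq324BenfattoClassCollar
import Literature.MathematicalPhysics.QuantumFieldTheory.Balaban1983to89.B1Eq324BenfattoClassEntryRows
import Literature.MathematicalPhysics.QuantumFieldTheory.Balaban1983to89.B1Eq324BenfattoKernelSect5ClassBasicLemma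
import HarnessLib

/-!
# `Balaban1983to89.B1Eq324BenfattoKernelEq324` — [Balaban1982Higgs1] (3.24) p. 616 «⟨χ exp(V)⟩ = exp[⟨V⟩ + … + (1/n̄!)⟨V^n̄⟩ᵀ + O(εᵏ)|T₁|]»
# FOR THE GAUSSIAN FIELD OF A CLASS KERNEL ([BenfattoEtAl1978] Lemma p. 152 in OUR class form of [Balaban1985BackgroundPropagators] Sect. E),
# from seat n08-c's signed class Basic Lemma and the measure-free `η`-bookkeeping; with the INDEPENDENT COLLAR the support of `H_J` may reach `∂Λ`
# — PROVED, no definition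

statement-level skeleton of published theorems with citation tags; proofs where landed; nothing here is a claim about the
Yang–Mills mass gap

WHY THIS MODULE (cell `pub-ymgap`, seat `dag-n08-d` gen 14, INTENT-72 (reserved I.36848, n08-c «agreed, yours»); node N08 [Balaban1985UV3]; the
[BenfattoEtAl1978] source chain behind the (α)-row `h324c`).  The class road (seats n08-b / n08-c / n08-d / n08-w5) ends in
`…KernelSect5ClassBasicLemma.classBasicLemma_signed` (p634629): the two-sided sandwich `exp(Σ − |I|S(…)) ≤ ∫Π_Δχ̂_b e^{H_J} dμ_K ≤ exp(Σ + |I|S(…))` for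
every class member, ONE threshold `b*` and ONE signed constant package, with print's «C at distance b³» and OUR interior pad on `J`.  This file turns it
into B1's (3.24) in `η`-currency for `μ_K = 𝒩(0, K)`, the analogue of g10's `…ModelEq324` for [2]'s model: §2 per instance through
`…Eq324Signed.eq324_of_sandwich_consts` (measure-free, p627662) at `C = ∅` (`…KernelCondField.condFieldK_empty`), pad displayed; §3 WITHOUT the pad —
for ANY `J ⊆ Λ` — by padding the member with an independent collar (`…ClassCollar`, p633772: the lemma applies to `(Λ ∪ P, A ⊕ γ_A·1_P)` where the pad
holds, the sandwich transfers back at the cost of the collar's small-field volume `≥ e^{−|I|·4·8^d e^{−γ_A p(η)²/2}}`, which beats every power of `η`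
because `p(η)² ≍ (log η⁻¹)^{2p₀}`, `2p₀ > 1`); §4 unconditional, the growth rows taken from the lattice (`…ClassEntryRows`, p628039).

WHAT IS PROVED (standard axioms; no `sorry`; no definition).
* §1 ★ `eq324Shape_of_sandwich_consts` — the measure-free (3.24) in the lane's binder shape `B1Sect3Statements.Eq324 (∫…) (n ↦ truncatedExp μ H_J n) t C η κ |I|`.
* §2 ★★ `eq324_of_classSigned`, `eq324Shape_of_classSigned` — from the signed class shape (inline hypothesis = `classBasicLemma_signed`'s conclusion,
  verbatim): `∃ η₀ C, ∀ η ≤ η₀, ∀ member, ∀ (s, I, J, a)` with the `p(η)²`-pad of `J` in `Λ` and `coefSup ≤ c·η^σ`: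
  `0 < ∫Π_Δχ̂_{p(η)}e^{H_J}dμ_K ∧ |log ∫ − cumulantSum μ_K H_J t| ≤ C·η^κ·|I|`.
* §3 `exp_neg_pFun_sq_le_rpow` (the collar defect at the threshold beats `η^κ`); ★★★ `eq324_of_classSigned_noPad` — the same with `J ⊆ Λ` ARBITRARY (the
  class shape taken at the collar members' constants `(V, max M γ_A, V₂, max M₂ γ_A, V₄)`, growth rows Λ-uniform).
* §4 ★★★ `eq324_kernel` (= §2 ∘ `classBasicLemma_signed`); ★★★★ `eq324_kernel_noPad` — UNCONDITIONAL, NO PAD, growth rows from the lattice: for `0 < d`,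
  `2 ≤ γ_A`, `0 ≤ J_c < γ_A`, `θ > 0`, `M, M₂ ≥ 0`, every `t D ϰ b₀ p₀ σ c` and `0 < κ < σ(t+1)`: `∃ η₀ C`, for all `η ≤ η₀`, every member `(Λ, A, K)` with ONLY
  (`hK`, `Λ ≠ ∅`, symmetry, `γ_A`-coercivity, the rows `J_c`, `M`, `M₂`) and every `(s, I ⊇ J, a)`, `I ≠ ∅`, `J ⊆ Λ`, `coefSup ≤ c·η^σ`: the (3.24) pair;
  `eq324_kernel_noPad_seven` (`t = 6`, `σ = ½`, `κ = 13/4 > 3` — B1's «e.g. n > 6», [Balaban1985UV3] p. 261 «up to the sixth order»).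
HONEST SCOPE.  (3.24) for the Gaussian field of OUR class (finite `Λ ⊂ ℤ^d`, Euclidean rows; the normalisation `γ_A ≥ 2` is the knit's — seat n08-b's
`…ClassRescale` removes it by rescaling the field); the IDENTIFICATION of [Balaban1985UV3]'s fluctuation integrals (22)/(58) with instances — the member, its
coercivity/range from N06 [Balaban1985UV2], the cut-offs and 𝒱 through seat n08-w4's (α)-socket, and seat n08-w4's CHECK C (wrapped regions of the torus) —
is NOT claimed; `BasicLemmaPrinted` for [2]'s model is g10's `…ModelEq324`, not this; count-neutral for N08; nothing about d = 4, the continuum, OS axioms,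
a mass gap or the Clay problem.
-/

noncomputable section

open MeasureTheory Finset Matrix

namespace Literature.MathematicalPhysics.QuantumFieldTheory.Balaban1983to89.B1Eq324BenfattoKernelEq324

open Literature.MathematicalPhysics.QuantumFieldTheory
open Literature.MathematicalPhysics.QuantumFieldTheory.Balaban1983to89.B1Eq324BenfattoLemma
open Literature.MathematicalPhysics.QuantumFieldTheory.Balaban1983to89.B1Eq324BenfattoSpecialisation
open Literature.MathematicalPhysics.QuantumFieldTheory.Balaban1983to89.B1Eq324BenfattoEq324Signed
open Literature.MathematicalPhysics.QuantumFieldTheory.Balaban1983to89.B1Eq324CumulantTaylor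
open Literature.MathematicalPhysics.QuantumFieldTheory.Balaban1983to89.B1Eq324BenfattoKernelCondField (condFieldK_empty)
open Literature.MathematicalPhysics.QuantumFieldTheory.Balaban1983to89.B1Eq324BenfattoKernelOfPrecision (isPosSemidefKernel_kernel)
open Literature.MathematicalPhysics.QuantumFieldTheory.Balaban1983to89.B1Eq324BenfattoClassAppendixC (posDef_of_coercive)

variable {d : ℕ}

/-! ## §1  (3.24) measure-free, in the lane's `Eq324` binder shape -/

/-- ★★ **(3.24) IN THE LANE's BINDER SHAPE, MEASURE-FREE**: under the hypotheses of `…Eq324Signed.eq324_of_sandwich_consts`, for every `η ≤ η₀`,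
every measure `μ` and every instance `(s, I, J, a)` with `coefSup ≤ c·η^σ` satisfying the two-sided sandwich at `b = p(η)`:
`B1Sect3Statements.Eq324 (∫Π_Δχ̂_{p(η)}e^{H_J}dμ) (n ↦ truncatedExp μ H_J n) t C η κ |I|` (i.e. `⟨Πχ̂ e^{H_J}⟩_μ = exp[Σ_{n≤t} ⟨H_Jⁿ⟩ᵀ_μ/n! + r]`,
`|r| ≤ C·η^κ·|I|`) — `eq324_of_sandwich_consts` read through `…CumulantTaylor.eq324_iff_abs_log_sub_le`.
[cite: Balaban1982Higgs1, (3.24) p.616; BenfattoEtAl1978, Lemma p.152, Remark 4 p.153] -/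
theorem eq324Shape_of_sandwich_consts {t D : ℕ} {ϰ bstar S ρ₁ ρ₂ ρ₃ ρ₄ b₀ p₀ σ c κ : ℝ}
    (hS : 0 ≤ S) (hρ₃ : 0 < ρ₃) (hb₀ : 0 < b₀) (hp₀ : 2 / 3 < p₀) (hσ : 0 < σ) (hc : 0 ≤ c) (hκ : 0 < κ) (hκσ : κ < σ * (t + 1)) :
    ∃ η₀ C : ℝ, 0 < η₀ ∧ η₀ ≤ 1 ∧ 0 ≤ C ∧ ∀ η : ℝ, 0 < η → η ≤ η₀ →
      bstar < B10.pFun b₀ p₀ η ∧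
      ∀ (μ : Measure ((Fin d → ℤ) → ℝ)) (s : ℕ) (I J : Finset (Fin d → ℤ)) (a : Coef d), coefSup s D a J ≤ c * η ^ σ →
        Real.exp (cumulantSum μ (hamiltonian s D ϰ a J) t -
              (I.card : ℝ) * errTerm S ρ₁ ρ₂ ρ₃ ρ₄ (coefSup s D a J) (B10.pFun b₀ p₀ η) t) ≤
            ∫ z, cutoffBoltzmann (hamiltonian s D ϰ a J) I (B10.pFun b₀ p₀ η) z ∂μ →
        ∫ z, cutoffBoltzmann (hamiltonian s D ϰ a J) I (B10.pFun b₀ p₀ η) z ∂μ ≤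
            Real.exp (cumulantSum μ (hamiltonian s D ϰ a J) t +
              (I.card : ℝ) * errTerm S ρ₁ ρ₂ ρ₃ ρ₄ (coefSup s D a J) (B10.pFun b₀ p₀ η) t) →
        B1Sect3Statements.Eq324 (∫ z, cutoffBoltzmann (hamiltonian s D ϰ a J) I (B10.pFun b₀ p₀ η) z ∂μ)
          (fun n => truncatedExp μ (hamiltonian s D ϰ a J) n) t C η κ I.card := by
  obtain ⟨η₀, C, hη₀, hη₀1, hC, h⟩ :=
    eq324_of_sandwich_consts (d := d) (D := D) (ϰ := ϰ) (bstar := bstar) (ρ₁ := ρ₁) (ρ₂ := ρ₂) (ρ₄ := ρ₄) hS hρ₃ hb₀ hp₀ hσ hc hκ hκσ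
  refine ⟨η₀, C, hη₀, hη₀1, hC, fun η hη hηle => ⟨(h η hη hηle).1, fun μ s I J a hA hlow hup => ?_⟩⟩
  obtain ⟨hpos, habs⟩ := (h η hη hηle).2 μ s I J a hA hlow hup
  rw [eq324_iff_abs_log_sub_le hpos]
  simpa only [cumulantSum] using habs


/-! ## §2  (3.24) for the Gaussian field of a class kernel, interior-supported Hamiltonians (the lemma's pad displayed) -/

variable {γA Jc θ V M V₂ M₂ V₄ : ℝ}

/-- ★★ **[Balaban1982Higgs1] (3.24) FOR THE GAUSSIAN FIELD OF A CLASS KERNEL (interior-supported Hamiltonians)**, from the SIGNED class Basic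
Lemma (`…KernelSect5ClassBasicLemma.classBasicLemma_signed`'s conclusion, here an inline hypothesis): for every `t D`, `ϰ > 0`, `b₀ > 0`, `p₀ > 2/3`,
`σ > 0`, `c ≥ 0`, `0 < κ < σ(t+1)` there are `η₀ ∈ (0,1]`, `C ≥ 0` such that for all `η ≤ η₀`, every class member `(Λ, A, K)` with the displayed rows, and
every `(s, I, J, a)` with `I ≠ ∅`, `J ⊆ I`, the `p(η)²`-pad of `J` inside `Λ` and `coefSup ≤ c·η^σ`:
`0 < ∫Π_Δχ̂_{p(η)}e^{H_J}dμ_K` and `|log ∫Π_Δχ̂_{p(η)}e^{H_J}dμ_K − cumulantSum μ_K H_J t| ≤ C·η^κ·|I|`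
(`eq324_of_sandwich_consts` per instance at `μ := μ_K`; the (4.6) half at `C = ∅` read through `…KernelCondField.condFieldK_empty`).
[cite: Balaban1982Higgs1, (3.24) p.616; BenfattoEtAl1978, Lemma (4.5)–(4.7) p.152, Remark 4 p.153; Balaban1985BackgroundPropagators, Sect. E p.428 (class form; ours)] -/
theorem eq324_of_classSigned
    (h :
    ∃ bstar : ℝ, ∀ (t D : ℕ) (ϰ : ℝ), 0 < ϰ →
      ∃ S ρ₁ ρ₂ ρ₃ ρ₄ : ℝ, 0 ≤ S ∧ 0 < ρ₃ ∧
        ∀ {Λ : Finset (B1Eq324BenfattoLemma.Site d)} {A : Matrix Λ Λ ℝ} {K : B1Eq324BenfattoLemma.Site d → B1Eq324BenfattoLemma.Site d → ℝ},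
          (∀ x y, K x y = if h : x ∈ Λ ∧ y ∈ Λ then (A⁻¹ : Matrix Λ Λ ℝ) ⟨x, h.1⟩ ⟨y, h.2⟩ else 0) → Λ.Nonempty →
          (∀ e e', A e e' = A e' e) → (∀ x : Λ → ℝ, γA * ∑ e, x e ^ 2 ≤ ∑ e, ∑ e', A e e' * x e * x e') →
          (∀ e : Λ, ∑ e' : Λ, |A e e'| * (Real.cosh (θ * Real.sqrt (∑ j, ((((e : B1Eq324BenfattoLemma.Site d) j : ℝ) - ((e' : B1Eq324BenfattoLemma.Site d) j : ℝ))) ^ 2)) - 1) ≤ Jc) →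
          (∀ e : Λ, ∑ e' : Λ, Real.exp (-(θ * Real.sqrt (∑ j, ((((e : B1Eq324BenfattoLemma.Site d) j : ℝ) - ((e' : B1Eq324BenfattoLemma.Site d) j : ℝ))) ^ 2))) *
            (1 + Real.sqrt (∑ j, ((((e : B1Eq324BenfattoLemma.Site d) j : ℝ) - ((e' : B1Eq324BenfattoLemma.Site d) j : ℝ))) ^ 2)) ≤ V) →
          (∀ e : Λ, ∑ e' : Λ, |A e e'| * (1 + Real.sqrt (∑ j, ((((e : B1Eq324BenfattoLemma.Site d) j : ℝ) - ((e' : B1Eq324BenfattoLemma.Site d) j : ℝ))) ^ 2)) ≤ M) →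
          (∀ e : Λ, ∑ e' : Λ, Real.exp (-(θ / 2 * Real.sqrt (∑ j, ((((e : B1Eq324BenfattoLemma.Site d) j : ℝ) - ((e' : B1Eq324BenfattoLemma.Site d) j : ℝ))) ^ 2))) ≤ V₂) →
          (∀ e : Λ, ∑ e' : Λ, |A e e'| * Real.exp (θ / 2 * Real.sqrt (∑ j, ((((e : B1Eq324BenfattoLemma.Site d) j : ℝ) - ((e' : B1Eq324BenfattoLemma.Site d) j : ℝ))) ^ 2)) ≤ M₂) →
          (∀ e : Λ, ∑ e' : Λ, Real.exp (-(θ / 4 * Real.sqrt (∑ j, ((((e : B1Eq324BenfattoLemma.Site d) j : ℝ) - ((e' : B1Eq324BenfattoLemma.Site d) j : ℝ))) ^ 2))) *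
            (1 + Real.sqrt (∑ j, ((((e : B1Eq324BenfattoLemma.Site d) j : ℝ) - ((e' : B1Eq324BenfattoLemma.Site d) j : ℝ))) ^ 2)) ≤ V₄) →
          ∀ (s : ℕ) (b : ℝ), bstar < b → ∀ (I J : Finset (B1Eq324BenfattoLemma.Site d)), I.Nonempty → J ⊆ I →
            (∀ x ∈ J, ∀ z : B1Eq324BenfattoLemma.Site d, (∀ i, ((|z i - x i| : ℤ) : ℝ) ≤ b ^ 2) → z ∈ Λ) → ∀ a : Coef d,
            (∀ (C : Finset (B1Eq324BenfattoLemma.Site d)) (zbar : B1Eq324BenfattoLemma.Site d → ℝ), C ⊆ Λ →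
                (∀ c ∈ C, ∀ x ∈ J, b ^ 3 + Real.sqrt d * (b ^ 2 + 1) ≤ Real.sqrt (∑ j, (((x j : ℝ) - (c j : ℝ))) ^ 2)) →
                ∫ z, cutoffBoltzmann (hamiltonian s D ϰ a J) I b z ∂((gaussianFieldOfKernel (condCov K C)).map
                    fun (ζ' : B1Eq324BenfattoLemma.Site d → ℝ) (x : B1Eq324BenfattoLemma.Site d) => condMean K C zbar x + ζ' x) ≤
                  Real.exp (cumulantSum (gaussianFieldOfKernel K) (hamiltonian s D ϰ a J) t +
                    (I.card : ℝ) * errTerm S ρ₁ ρ₂ ρ₃ ρ₄ (coefSup s D a J) b t)) ∧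
            Real.exp (cumulantSum (gaussianFieldOfKernel K) (hamiltonian s D ϰ a J) t -
                  (I.card : ℝ) * errTerm S ρ₁ ρ₂ ρ₃ ρ₄ (coefSup s D a J) b t) ≤
                ∫ z, cutoffBoltzmann (hamiltonian s D ϰ a J) I b z ∂gaussianFieldOfKernel K)
    (t D : ℕ) {ϰ : ℝ} (hϰ : 0 < ϰ) {b₀ p₀ σ c κ : ℝ} (hb₀ : 0 < b₀) (hp₀ : 2 / 3 < p₀) (hσ : 0 < σ) (hc : 0 ≤ c) (hκ : 0 < κ)
    (hκσ : κ < σ * (t + 1)) :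
    ∃ η₀ C : ℝ, 0 < η₀ ∧ η₀ ≤ 1 ∧ 0 ≤ C ∧ ∀ η : ℝ, 0 < η → η ≤ η₀ →
      ∀ {Λ : Finset (B1Eq324BenfattoLemma.Site d)} {A : Matrix Λ Λ ℝ} {K : B1Eq324BenfattoLemma.Site d → B1Eq324BenfattoLemma.Site d → ℝ},
        (∀ x y, K x y = if h : x ∈ Λ ∧ y ∈ Λ then (A⁻¹ : Matrix Λ Λ ℝ) ⟨x, h.1⟩ ⟨y, h.2⟩ else 0) → Λ.Nonempty →
        (∀ e e', A e e' = A e' e) → (∀ x : Λ → ℝ, γA * ∑ e, x e ^ 2 ≤ ∑ e, ∑ e', A e e' * x e * x e') →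
        (∀ e : Λ, ∑ e' : Λ, |A e e'| * (Real.cosh (θ * Real.sqrt (∑ j, ((((e : B1Eq324BenfattoLemma.Site d) j : ℝ) - ((e' : B1Eq324BenfattoLemma.Site d) j : ℝ))) ^ 2)) - 1) ≤ Jc) →
        (∀ e : Λ, ∑ e' : Λ, Real.exp (-(θ * Real.sqrt (∑ j, ((((e : B1Eq324BenfattoLemma.Site d) j : ℝ) - ((e' : B1Eq324BenfattoLemma.Site d) j : ℝ))) ^ 2))) *
          (1 + Real.sqrt (∑ j, ((((e : B1Eq324BenfattoLemma.Site d) j : ℝ) - ((e' : B1Eq324BenfattoLemma.Site d) j : ℝ))) ^ 2)) ≤ V) →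
        (∀ e : Λ, ∑ e' : Λ, |A e e'| * (1 + Real.sqrt (∑ j, ((((e : B1Eq324BenfattoLemma.Site d) j : ℝ) - ((e' : B1Eq324BenfattoLemma.Site d) j : ℝ))) ^ 2)) ≤ M) →
        (∀ e : Λ, ∑ e' : Λ, Real.exp (-(θ / 2 * Real.sqrt (∑ j, ((((e : B1Eq324BenfattoLemma.Site d) j : ℝ) - ((e' : B1Eq324BenfattoLemma.Site d) j : ℝ))) ^ 2))) ≤ V₂) →
        (∀ e : Λ, ∑ e' : Λ, |A e e'| * Real.exp (θ / 2 * Real.sqrt (∑ j, ((((e : B1Eq324BenfattoLemma.Site d) j : ℝ) - ((e' : B1Eq324BenfattoLemma.Site d) j : ℝ))) ^ 2)) ≤ M₂) →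
        (∀ e : Λ, ∑ e' : Λ, Real.exp (-(θ / 4 * Real.sqrt (∑ j, ((((e : B1Eq324BenfattoLemma.Site d) j : ℝ) - ((e' : B1Eq324BenfattoLemma.Site d) j : ℝ))) ^ 2))) *
          (1 + Real.sqrt (∑ j, ((((e : B1Eq324BenfattoLemma.Site d) j : ℝ) - ((e' : B1Eq324BenfattoLemma.Site d) j : ℝ))) ^ 2)) ≤ V₄) →
        ∀ (s : ℕ) (I J : Finset (B1Eq324BenfattoLemma.Site d)) (a : Coef d), I.Nonempty → J ⊆ I →
          (∀ x ∈ J, ∀ z : B1Eq324BenfattoLemma.Site d, (∀ i, ((|z i - x i| : ℤ) : ℝ) ≤ B10.pFun b₀ p₀ η ^ 2) → z ∈ Λ) →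
          coefSup s D a J ≤ c * η ^ σ →
          0 < ∫ z, cutoffBoltzmann (hamiltonian s D ϰ a J) I (B10.pFun b₀ p₀ η) z ∂gaussianFieldOfKernel K ∧
            |Real.log (∫ z, cutoffBoltzmann (hamiltonian s D ϰ a J) I (B10.pFun b₀ p₀ η) z ∂gaussianFieldOfKernel K) -
                cumulantSum (gaussianFieldOfKernel K) (hamiltonian s D ϰ a J) t| ≤ C * η ^ κ * I.card := by
  obtain ⟨bstar, hBL⟩ := h
  obtain ⟨S, ρ₁, ρ₂, ρ₃, ρ₄, hS, hρ₃, hall⟩ := hBL t D ϰ hϰ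
  obtain ⟨η₀, C, hη₀, hη₀1, hC, hE⟩ :=
    eq324_of_sandwich_consts (d := d) (D := D) (ϰ := ϰ) (bstar := bstar) (ρ₁ := ρ₁) (ρ₂ := ρ₂) (ρ₄ := ρ₄) hS hρ₃ hb₀ hp₀ hσ hc hκ hκσ
  refine ⟨η₀, C, hη₀, hη₀1, hC, ?_⟩
  intro η hη hηle Λ A K hK hΛ hAs hγA hJc hV hM hV₂ hM₂ hV₄ s I J a hI hJI hpad hA
  obtain ⟨hb, hη'⟩ := hE η hη hηle
  obtain ⟨h46, h47⟩ := hall hK hΛ hAs hγA hJc hV hM hV₂ hM₂ hV₄ s (B10.pFun b₀ p₀ η) hb I J hI hJI hpad a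
  have hup := h46 ∅ (fun _ => 0) (Finset.empty_subset _) (fun c hc => absurd hc (Finset.notMem_empty _))
  rw [condFieldK_empty] at hup
  exact hη' (gaussianFieldOfKernel K) s I J a hA h47 hup

/-- ★★ **The same in the lane's `Eq324` binder shape**: `B1Sect3Statements.Eq324 (∫Π_Δχ̂_{p(η)}e^{H_J}dμ_K) (n ↦ truncatedExp μ_K H_J n) t C η κ |I|`.
[cite: Balaban1982Higgs1, (3.24) p.616; BenfattoEtAl1978, Lemma p.152 (class form; ours)] -/
theorem eq324Shape_of_classSigned
    (h :
    ∃ bstar : ℝ, ∀ (t D : ℕ) (ϰ : ℝ), 0 < ϰ →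
      ∃ S ρ₁ ρ₂ ρ₃ ρ₄ : ℝ, 0 ≤ S ∧ 0 < ρ₃ ∧
        ∀ {Λ : Finset (B1Eq324BenfattoLemma.Site d)} {A : Matrix Λ Λ ℝ} {K : B1Eq324BenfattoLemma.Site d → B1Eq324BenfattoLemma.Site d → ℝ},
          (∀ x y, K x y = if h : x ∈ Λ ∧ y ∈ Λ then (A⁻¹ : Matrix Λ Λ ℝ) ⟨x, h.1⟩ ⟨y, h.2⟩ else 0) → Λ.Nonempty →
          (∀ e e', A e e' = A e' e) → (∀ x : Λ → ℝ, γA * ∑ e, x e ^ 2 ≤ ∑ e, ∑ e', A e e' * x e * x e') →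
          (∀ e : Λ, ∑ e' : Λ, |A e e'| * (Real.cosh (θ * Real.sqrt (∑ j, ((((e : B1Eq324BenfattoLemma.Site d) j : ℝ) - ((e' : B1Eq324BenfattoLemma.Site d) j : ℝ))) ^ 2)) - 1) ≤ Jc) →
          (∀ e : Λ, ∑ e' : Λ, Real.exp (-(θ * Real.sqrt (∑ j, ((((e : B1Eq324BenfattoLemma.Site d) j : ℝ) - ((e' : B1Eq324BenfattoLemma.Site d) j : ℝ))) ^ 2))) *
            (1 + Real.sqrt (∑ j, ((((e : B1Eq324BenfattoLemma.Site d) j : ℝ) - ((e' : B1Eq324BenfattoLemma.Site d) j : ℝ))) ^ 2)) ≤ V) →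
          (∀ e : Λ, ∑ e' : Λ, |A e e'| * (1 + Real.sqrt (∑ j, ((((e : B1Eq324BenfattoLemma.Site d) j : ℝ) - ((e' : B1Eq324BenfattoLemma.Site d) j : ℝ))) ^ 2)) ≤ M) →
          (∀ e : Λ, ∑ e' : Λ, Real.exp (-(θ / 2 * Real.sqrt (∑ j, ((((e : B1Eq324BenfattoLemma.Site d) j : ℝ) - ((e' : B1Eq324BenfattoLemma.Site d) j : ℝ))) ^ 2))) ≤ V₂) →
          (∀ e : Λ, ∑ e' : Λ, |A e e'| * Real.exp (θ / 2 * Real.sqrt (∑ j, ((((e : B1Eq324BenfattoLemma.Site d) j : ℝ) - ((e' : B1Eq324BenfattoLemma.Site d) j : ℝ))) ^ 2)) ≤ M₂) →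
          (∀ e : Λ, ∑ e' : Λ, Real.exp (-(θ / 4 * Real.sqrt (∑ j, ((((e : B1Eq324BenfattoLemma.Site d) j : ℝ) - ((e' : B1Eq324BenfattoLemma.Site d) j : ℝ))) ^ 2))) *
            (1 + Real.sqrt (∑ j, ((((e : B1Eq324BenfattoLemma.Site d) j : ℝ) - ((e' : B1Eq324BenfattoLemma.Site d) j : ℝ))) ^ 2)) ≤ V₄) →
          ∀ (s : ℕ) (b : ℝ), bstar < b → ∀ (I J : Finset (B1Eq324BenfattoLemma.Site d)), I.Nonempty → J ⊆ I →
            (∀ x ∈ J, ∀ z : B1Eq324BenfattoLemma.Site d, (∀ i, ((|z i - x i| : ℤ) : ℝ) ≤ b ^ 2) → z ∈ Λ) → ∀ a : Coef d,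
            (∀ (C : Finset (B1Eq324BenfattoLemma.Site d)) (zbar : B1Eq324BenfattoLemma.Site d → ℝ), C ⊆ Λ →
                (∀ c ∈ C, ∀ x ∈ J, b ^ 3 + Real.sqrt d * (b ^ 2 + 1) ≤ Real.sqrt (∑ j, (((x j : ℝ) - (c j : ℝ))) ^ 2)) →
                ∫ z, cutoffBoltzmann (hamiltonian s D ϰ a J) I b z ∂((gaussianFieldOfKernel (condCov K C)).map
                    fun (ζ' : B1Eq324BenfattoLemma.Site d → ℝ) (x : B1Eq324BenfattoLemma.Site d) => condMean K C zbar x + ζ' x) ≤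
                  Real.exp (cumulantSum (gaussianFieldOfKernel K) (hamiltonian s D ϰ a J) t +
                    (I.card : ℝ) * errTerm S ρ₁ ρ₂ ρ₃ ρ₄ (coefSup s D a J) b t)) ∧
            Real.exp (cumulantSum (gaussianFieldOfKernel K) (hamiltonian s D ϰ a J) t -
                  (I.card : ℝ) * errTerm S ρ₁ ρ₂ ρ₃ ρ₄ (coefSup s D a J) b t) ≤
                ∫ z, cutoffBoltzmann (hamiltonian s D ϰ a J) I b z ∂gaussianFieldOfKernel K)
    (t D : ℕ) {ϰ : ℝ} (hϰ : 0 < ϰ) {b₀ p₀ σ c κ : ℝ} (hb₀ : 0 < b₀) (hp₀ : 2 / 3 < p₀) (hσ : 0 < σ) (hc : 0 ≤ c) (hκ : 0 < κ)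
    (hκσ : κ < σ * (t + 1)) :
    ∃ η₀ C : ℝ, 0 < η₀ ∧ η₀ ≤ 1 ∧ 0 ≤ C ∧ ∀ η : ℝ, 0 < η → η ≤ η₀ →
      ∀ {Λ : Finset (B1Eq324BenfattoLemma.Site d)} {A : Matrix Λ Λ ℝ} {K : B1Eq324BenfattoLemma.Site d → B1Eq324BenfattoLemma.Site d → ℝ},
        (∀ x y, K x y = if h : x ∈ Λ ∧ y ∈ Λ then (A⁻¹ : Matrix Λ Λ ℝ) ⟨x, h.1⟩ ⟨y, h.2⟩ else 0) → Λ.Nonempty →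
        (∀ e e', A e e' = A e' e) → (∀ x : Λ → ℝ, γA * ∑ e, x e ^ 2 ≤ ∑ e, ∑ e', A e e' * x e * x e') →
        (∀ e : Λ, ∑ e' : Λ, |A e e'| * (Real.cosh (θ * Real.sqrt (∑ j, ((((e : B1Eq324BenfattoLemma.Site d) j : ℝ) - ((e' : B1Eq324BenfattoLemma.Site d) j : ℝ))) ^ 2)) - 1) ≤ Jc) →
        (∀ e : Λ, ∑ e' : Λ, Real.exp (-(θ * Real.sqrt (∑ j, ((((e : B1Eq324BenfattoLemma.Site d) j : ℝ) - ((e' : B1Eq324BenfattoLemma.Site d) j : ℝ))) ^ 2))) *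
          (1 + Real.sqrt (∑ j, ((((e : B1Eq324BenfattoLemma.Site d) j : ℝ) - ((e' : B1Eq324BenfattoLemma.Site d) j : ℝ))) ^ 2)) ≤ V) →
        (∀ e : Λ, ∑ e' : Λ, |A e e'| * (1 + Real.sqrt (∑ j, ((((e : B1Eq324BenfattoLemma.Site d) j : ℝ) - ((e' : B1Eq324BenfattoLemma.Site d) j : ℝ))) ^ 2)) ≤ M) →
        (∀ e : Λ, ∑ e' : Λ, Real.exp (-(θ / 2 * Real.sqrt (∑ j, ((((e : B1Eq324BenfattoLemma.Site d) j : ℝ) - ((e' : B1Eq324BenfattoLemma.Site d) j : ℝ))) ^ 2))) ≤ V₂) →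
        (∀ e : Λ, ∑ e' : Λ, |A e e'| * Real.exp (θ / 2 * Real.sqrt (∑ j, ((((e : B1Eq324BenfattoLemma.Site d) j : ℝ) - ((e' : B1Eq324BenfattoLemma.Site d) j : ℝ))) ^ 2)) ≤ M₂) →
        (∀ e : Λ, ∑ e' : Λ, Real.exp (-(θ / 4 * Real.sqrt (∑ j, ((((e : B1Eq324BenfattoLemma.Site d) j : ℝ) - ((e' : B1Eq324BenfattoLemma.Site d) j : ℝ))) ^ 2))) *
          (1 + Real.sqrt (∑ j, ((((e : B1Eq324BenfattoLemma.Site d) j : ℝ) - ((e' : B1Eq324BenfattoLemma.Site d) j : ℝ))) ^ 2)) ≤ V₄) →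
        ∀ (s : ℕ) (I J : Finset (B1Eq324BenfattoLemma.Site d)) (a : Coef d), I.Nonempty → J ⊆ I →
          (∀ x ∈ J, ∀ z : B1Eq324BenfattoLemma.Site d, (∀ i, ((|z i - x i| : ℤ) : ℝ) ≤ B10.pFun b₀ p₀ η ^ 2) → z ∈ Λ) →
          coefSup s D a J ≤ c * η ^ σ →
          B1Sect3Statements.Eq324 (∫ z, cutoffBoltzmann (hamiltonian s D ϰ a J) I (B10.pFun b₀ p₀ η) z ∂gaussianFieldOfKernel K)
            (fun n => truncatedExp (gaussianFieldOfKernel K) (hamiltonian s D ϰ a J) n) t C η κ I.card := by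
  obtain ⟨η₀, C, hη₀, hη₀1, hC, hE⟩ := eq324_of_classSigned h t D hϰ hb₀ hp₀ hσ hc hκ hκσ
  refine ⟨η₀, C, hη₀, hη₀1, hC, ?_⟩
  intro η hη hηle Λ A K hK hΛ hAs hγA hJc hV hM hV₂ hM₂ hV₄ s I J a hI hJI hpad hA
  obtain ⟨hpos, habs⟩ := hE η hη hηle hK hΛ hAs hγA hJc hV hM hV₂ hM₂ hV₄ s I J a hI hJI hpad hA
  rw [eq324_iff_abs_log_sub_le hpos]
  simpa only [cumulantSum] using habs


/-! ## §3  No pad: (3.24) for μ_K with `J` up to `∂Λ`, through the independent collar (`…ClassCollar`) -/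

/-- `1 ≤ 1 + log η⁻¹` on `(0, 1]` (private plumbing). [folklore] -/
private theorem one_le_one_add_log_inv {η : ℝ} (hη : 0 < η) (hη1 : η ≤ 1) : 1 ≤ 1 + Real.log η⁻¹ := by
  have := B10.log_inv_nonneg_of_le_one hη hη1
  linarith

/-- The logarithmic factor exceeds any level near `η = 0` (private plumbing, as in `…Specialisation`). [folklore] -/
private theorem exists_le_one_add_log_inv_rpow {a : ℝ} (ha : 0 < a) (M : ℝ) :
    ∃ η₀ : ℝ, 0 < η₀ ∧ η₀ ≤ 1 ∧ ∀ η : ℝ, 0 < η → η ≤ η₀ → M ≤ (1 + Real.log η⁻¹) ^ a := by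
  set L : ℝ := (max M 1) ^ (1 / a) with hL
  have hL1 : 1 ≤ L := by
    rw [hL]
    exact Real.one_le_rpow (le_max_right _ _) (by positivity)
  refine ⟨Real.exp (1 - L), Real.exp_pos _, ?_, fun η hη hηL => ?_⟩
  · exact Real.exp_le_one_iff.mpr (by linarith)
  · have hℓ : L ≤ 1 + Real.log η⁻¹ := by
      have h1 : Real.log η ≤ 1 - L := by
        rw [← Real.log_exp (1 - L)]
        exact Real.log_le_log hη hηL
      rw [Real.log_inv]
      linarith
    have hL0 : 0 ≤ L := zero_le_one.trans hL1
    calc M ≤ max M 1 := le_max_left _ _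
      _ = L ^ a := by
          rw [hL, ← Real.rpow_mul (le_trans zero_le_one (le_max_right _ _))]
          rw [one_div_mul_cancel ha.ne', Real.rpow_one]
      _ ≤ (1 + Real.log η⁻¹) ^ a := Real.rpow_le_rpow hL0 hℓ ha.le

/-- `e^{−Q} ≤ η^κ` once `κ(1 + log η⁻¹) ≤ Q` (private plumbing, as in `…Specialisation`). [folklore] -/
private theorem exp_neg_le_rpow {η κ Q : ℝ} (hη : 0 < η) (hκ : 0 ≤ κ) (hQ : κ * (1 + Real.log η⁻¹) ≤ Q) :
    Real.exp (-Q) ≤ η ^ κ := by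
  have hηκ : η ^ κ = Real.exp (κ - κ * (1 + Real.log η⁻¹)) := by
    rw [Real.rpow_def_of_pos hη, Real.log_inv]
    congr 1
    ring
  rw [hηκ]
  exact Real.exp_le_exp.mpr (by nlinarith)

/-- **The collar's defect at the threshold beats every power of `η`**: for `γ_A, b₀ > 0`, `p₀ > 1/2` and any `κ` there is `η₃ ∈ (0,1]` with
`exp(−p(η)²/(2γ_A⁻¹)) ≤ η^κ` for `η ∈ (0, η₃]` (`p(η)² = b₀²(1 + log η⁻¹)^{2p₀}` and `2p₀ > 1`). [cite: Balaban1985UV3, (7) p.257; Balaban1982Higgs1, (3.24) p.616] -/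
theorem exp_neg_pFun_sq_le_rpow {γA b₀ p₀ κ : ℝ} (hγA : 0 < γA) (hb₀ : 0 < b₀) (hp₀ : 1 / 2 < p₀) (hκ : 0 ≤ κ) :
    ∃ η₃ : ℝ, 0 < η₃ ∧ η₃ ≤ 1 ∧ ∀ η : ℝ, 0 < η → η ≤ η₃ →
      Real.exp (-(B10.pFun b₀ p₀ η ^ 2 / (2 * γA⁻¹))) ≤ η ^ κ := by
  obtain ⟨η₃, hη₃, hη₃1, hM⟩ := exists_le_one_add_log_inv_rpow (by linarith : 0 < 2 * p₀ - 1) (2 * κ / (γA * b₀ ^ 2))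
  refine ⟨η₃, hη₃, hη₃1, fun η hη hηle => ?_⟩
  have hη1 : η ≤ 1 := hηle.trans hη₃1
  have hL1 : 1 ≤ 1 + Real.log η⁻¹ := one_le_one_add_log_inv hη hη1
  have hL0 : 0 < 1 + Real.log η⁻¹ := lt_of_lt_of_le one_pos hL1
  refine exp_neg_le_rpow hη hκ ?_
  -- `κ(1+L) ≤ γ_A b₀² (1+L)(1+L)^{2p₀−1}/2 = p(η)²/(2γ_A⁻¹)`
  have hsq : B10.pFun b₀ p₀ η ^ 2 = b₀ ^ 2 * ((1 + Real.log η⁻¹) * (1 + Real.log η⁻¹) ^ (2 * p₀ - 1)) := by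
    rw [pFun_sq_eq b₀ hη hη1]
    congr 1
    conv_lhs => rw [show 2 * p₀ = 1 + (2 * p₀ - 1) by ring, Real.rpow_add hL0, Real.rpow_one]
  have hMle := hM η hη hηle
  have hb2 : 0 < γA * b₀ ^ 2 := by positivity
  calc κ * (1 + Real.log η⁻¹) = γA * b₀ ^ 2 * ((1 + Real.log η⁻¹) * (2 * κ / (γA * b₀ ^ 2))) / 2 := by
        field_simp
    _ ≤ γA * b₀ ^ 2 * ((1 + Real.log η⁻¹) * (1 + Real.log η⁻¹) ^ (2 * p₀ - 1)) / 2 := by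
        have := mul_le_mul_of_nonneg_left hMle hL0.le
        have := mul_le_mul_of_nonneg_left this hb2.le
        linarith
    _ = B10.pFun b₀ p₀ η ^ 2 / (2 * γA⁻¹) := by
        rw [hsq]
        field_simp

/-- ★★★ **[Balaban1982Higgs1] (3.24) FOR THE GAUSSIAN FIELD OF A CLASS KERNEL — NO PAD: `J` MAY REACH `∂Λ`.**  From the signed class Basic Lemma at
the constants `(γ_A, J_c, θ, V, max M γ_A, V₂, max M₂ γ_A, V₄)` (an inline hypothesis — the collar members' constants), with the growth rows in their
Λ-UNIFORM form (`…ClassEntryRows.classRow_V_le / V₂ / V₄` supply them for every finite window): for every `t D`, `ϰ > 0`, `b₀ > 0`, `p₀ > 2/3`, `σ > 0`,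
`c ≥ 0`, `0 < κ < σ(t+1)` there are `η₀ ∈ (0,1]`, `C ≥ 0` such that for all `η ≤ η₀`, every member `(Λ, A, K)` (`Λ ≠ ∅`, `A` symmetric `γ_A`-coercive with
rows `J_c, M, M₂`), every `(s, I, J, a)` with `I ≠ ∅`, `J ⊆ I`, `J ⊆ Λ` and `coefSup ≤ c·η^σ`:
`0 < ∫Π_Δχ̂_{p(η)}e^{H_J}dμ_K ∧ |log ∫Π_Δχ̂_{p(η)}e^{H_J}dμ_K − cumulantSum μ_K H_J t| ≤ C·η^κ·|I|`.
Proof: pad `Λ` by the independent collar `P = pad_{p(η)²}(J) ∖ Λ`, `A′ = A ⊕ γ_A·1_P` (`…ClassCollar` §1: a member with the displayed constants in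
which the lemma's pad holds), apply the lemma there, transfer (`…ClassCollar.sandwich_of_collar_sandwich`), and absorb the collar's defect
`|I|·4·8^d·e^{−γ_A p(η)²/2}` by `exp_neg_pFun_sq_le_rpow`; the printed error by `…Specialisation.errTerm_pFun_le`.
[cite: Balaban1982Higgs1, (3.24) p.616; BenfattoEtAl1978, Lemma (4.5)–(4.7) p.152 (on `ℤ^d`); Balaban1985BackgroundPropagators, Sect. E p.428 (class form; the collar is ours)] -/
theorem eq324_of_classSigned_noPad {γA Jc θ V M V₂ M₂ V₄ : ℝ} (hγA0 : 0 < γA) (hJc0 : 0 ≤ Jc)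
    (h :
    ∃ bstar : ℝ, ∀ (t D : ℕ) (ϰ : ℝ), 0 < ϰ →
      ∃ S ρ₁ ρ₂ ρ₃ ρ₄ : ℝ, 0 ≤ S ∧ 0 < ρ₃ ∧
        ∀ {Λ : Finset (B1Eq324BenfattoLemma.Site d)} {A : Matrix Λ Λ ℝ} {K : B1Eq324BenfattoLemma.Site d → B1Eq324BenfattoLemma.Site d → ℝ},
          (∀ x y, K x y = if h : x ∈ Λ ∧ y ∈ Λ then (A⁻¹ : Matrix Λ Λ ℝ) ⟨x, h.1⟩ ⟨y, h.2⟩ else 0) → Λ.Nonempty →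
          (∀ e e', A e e' = A e' e) → (∀ x : Λ → ℝ, γA * ∑ e, x e ^ 2 ≤ ∑ e, ∑ e', A e e' * x e * x e') →
          (∀ e : Λ, ∑ e' : Λ, |A e e'| * (Real.cosh (θ * Real.sqrt (∑ j, ((((e : B1Eq324BenfattoLemma.Site d) j : ℝ) - ((e' : B1Eq324BenfattoLemma.Site d) j : ℝ))) ^ 2)) - 1) ≤ Jc) →
          (∀ e : Λ, ∑ e' : Λ, Real.exp (-(θ * Real.sqrt (∑ j, ((((e : B1Eq324BenfattoLemma.Site d) j : ℝ) - ((e' : B1Eq324BenfattoLemma.Site d) j : ℝ))) ^ 2))) *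
            (1 + Real.sqrt (∑ j, ((((e : B1Eq324BenfattoLemma.Site d) j : ℝ) - ((e' : B1Eq324BenfattoLemma.Site d) j : ℝ))) ^ 2)) ≤ V) →
          (∀ e : Λ, ∑ e' : Λ, |A e e'| * (1 + Real.sqrt (∑ j, ((((e : B1Eq324BenfattoLemma.Site d) j : ℝ) - ((e' : B1Eq324BenfattoLemma.Site d) j : ℝ))) ^ 2)) ≤ max M γA) →
          (∀ e : Λ, ∑ e' : Λ, Real.exp (-(θ / 2 * Real.sqrt (∑ j, ((((e : B1Eq324BenfattoLemma.Site d) j : ℝ) - ((e' : B1Eq324BenfattoLemma.Site d) j : ℝ))) ^ 2))) ≤ V₂) →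
          (∀ e : Λ, ∑ e' : Λ, |A e e'| * Real.exp (θ / 2 * Real.sqrt (∑ j, ((((e : B1Eq324BenfattoLemma.Site d) j : ℝ) - ((e' : B1Eq324BenfattoLemma.Site d) j : ℝ))) ^ 2)) ≤ max M₂ γA) →
          (∀ e : Λ, ∑ e' : Λ, Real.exp (-(θ / 4 * Real.sqrt (∑ j, ((((e : B1Eq324BenfattoLemma.Site d) j : ℝ) - ((e' : B1Eq324BenfattoLemma.Site d) j : ℝ))) ^ 2))) *
            (1 + Real.sqrt (∑ j, ((((e : B1Eq324BenfattoLemma.Site d) j : ℝ) - ((e' : B1Eq324BenfattoLemma.Site d) j : ℝ))) ^ 2)) ≤ V₄) →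
          ∀ (s : ℕ) (b : ℝ), bstar < b → ∀ (I J : Finset (B1Eq324BenfattoLemma.Site d)), I.Nonempty → J ⊆ I →
            (∀ x ∈ J, ∀ z : B1Eq324BenfattoLemma.Site d, (∀ i, ((|z i - x i| : ℤ) : ℝ) ≤ b ^ 2) → z ∈ Λ) → ∀ a : Coef d,
            (∀ (C : Finset (B1Eq324BenfattoLemma.Site d)) (zbar : B1Eq324BenfattoLemma.Site d → ℝ), C ⊆ Λ →
                (∀ c ∈ C, ∀ x ∈ J, b ^ 3 + Real.sqrt d * (b ^ 2 + 1) ≤ Real.sqrt (∑ j, (((x j : ℝ) - (c j : ℝ))) ^ 2)) →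
                ∫ z, cutoffBoltzmann (hamiltonian s D ϰ a J) I b z ∂((gaussianFieldOfKernel (condCov K C)).map
                    fun (ζ' : B1Eq324BenfattoLemma.Site d → ℝ) (x : B1Eq324BenfattoLemma.Site d) => condMean K C zbar x + ζ' x) ≤
                  Real.exp (cumulantSum (gaussianFieldOfKernel K) (hamiltonian s D ϰ a J) t +
                    (I.card : ℝ) * errTerm S ρ₁ ρ₂ ρ₃ ρ₄ (coefSup s D a J) b t)) ∧
            Real.exp (cumulantSum (gaussianFieldOfKernel K) (hamiltonian s D ϰ a J) t -
                  (I.card : ℝ) * errTerm S ρ₁ ρ₂ ρ₃ ρ₄ (coefSup s D a J) b t) ≤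
                ∫ z, cutoffBoltzmann (hamiltonian s D ϰ a J) I b z ∂gaussianFieldOfKernel K)
    (hVu : (∀ (Λ₀ : Finset (B1Eq324BenfattoLemma.Site d)) (e : Λ₀), ∑ e' : Λ₀, Real.exp (-(θ * Real.sqrt (∑ j, ((((e : B1Eq324BenfattoLemma.Site d) j : ℝ) - ((e' : B1Eq324BenfattoLemma.Site d) j : ℝ))) ^ 2))) *
        (1 + Real.sqrt (∑ j, ((((e : B1Eq324BenfattoLemma.Site d) j : ℝ) - ((e' : B1Eq324BenfattoLemma.Site d) j : ℝ))) ^ 2)) ≤ V))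
    (hV₂u : (∀ (Λ₀ : Finset (B1Eq324BenfattoLemma.Site d)) (e : Λ₀), ∑ e' : Λ₀, Real.exp (-(θ / 2 * Real.sqrt (∑ j, ((((e : B1Eq324BenfattoLemma.Site d) j : ℝ) - ((e' : B1Eq324BenfattoLemma.Site d) j : ℝ))) ^ 2))) ≤ V₂))
    (hV₄u : (∀ (Λ₀ : Finset (B1Eq324BenfattoLemma.Site d)) (e : Λ₀), ∑ e' : Λ₀, Real.exp (-(θ / 4 * Real.sqrt (∑ j, ((((e : B1Eq324BenfattoLemma.Site d) j : ℝ) - ((e' : B1Eq324BenfattoLemma.Site d) j : ℝ))) ^ 2))) *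
        (1 + Real.sqrt (∑ j, ((((e : B1Eq324BenfattoLemma.Site d) j : ℝ) - ((e' : B1Eq324BenfattoLemma.Site d) j : ℝ))) ^ 2)) ≤ V₄))
    (t D : ℕ) {ϰ : ℝ} (hϰ : 0 < ϰ) {b₀ p₀ σ c κ : ℝ} (hb₀ : 0 < b₀) (hp₀ : 2 / 3 < p₀) (hσ : 0 < σ) (hc : 0 ≤ c) (hκ : 0 < κ)
    (hκσ : κ < σ * (t + 1)) :
    ∃ η₀ C : ℝ, 0 < η₀ ∧ η₀ ≤ 1 ∧ 0 ≤ C ∧ ∀ η : ℝ, 0 < η → η ≤ η₀ →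
      ∀ {Λ : Finset (B1Eq324BenfattoLemma.Site d)} {A : Matrix Λ Λ ℝ} {K : B1Eq324BenfattoLemma.Site d → B1Eq324BenfattoLemma.Site d → ℝ},
        (∀ x y, K x y = if h : x ∈ Λ ∧ y ∈ Λ then (A⁻¹ : Matrix Λ Λ ℝ) ⟨x, h.1⟩ ⟨y, h.2⟩ else 0) → Λ.Nonempty →
        (∀ e e', A e e' = A e' e) → (∀ x : Λ → ℝ, γA * ∑ e, x e ^ 2 ≤ ∑ e, ∑ e', A e e' * x e * x e') →
        (∀ e : Λ, ∑ e' : Λ, |A e e'| * (Real.cosh (θ * Real.sqrt (∑ j, ((((e : B1Eq324BenfattoLemma.Site d) j : ℝ) - ((e' : B1Eq324BenfattoLemma.Site d) j : ℝ))) ^ 2)) - 1) ≤ Jc) →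
        (∀ e : Λ, ∑ e' : Λ, |A e e'| * (1 + Real.sqrt (∑ j, ((((e : B1Eq324BenfattoLemma.Site d) j : ℝ) - ((e' : B1Eq324BenfattoLemma.Site d) j : ℝ))) ^ 2)) ≤ M) →
        (∀ e : Λ, ∑ e' : Λ, |A e e'| * Real.exp (θ / 2 * Real.sqrt (∑ j, ((((e : B1Eq324BenfattoLemma.Site d) j : ℝ) - ((e' : B1Eq324BenfattoLemma.Site d) j : ℝ))) ^ 2)) ≤ M₂) →
        ∀ (s : ℕ) (I J : Finset (B1Eq324BenfattoLemma.Site d)) (a : Coef d), I.Nonempty → J ⊆ I → J ⊆ Λ →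
          coefSup s D a J ≤ c * η ^ σ →
          0 < ∫ z, cutoffBoltzmann (hamiltonian s D ϰ a J) I (B10.pFun b₀ p₀ η) z ∂gaussianFieldOfKernel K ∧
            |Real.log (∫ z, cutoffBoltzmann (hamiltonian s D ϰ a J) I (B10.pFun b₀ p₀ η) z ∂gaussianFieldOfKernel K) -
                cumulantSum (gaussianFieldOfKernel K) (hamiltonian s D ϰ a J) t| ≤ C * η ^ κ * I.card := by
  classical
  obtain ⟨bstar, hBL⟩ := h
  obtain ⟨S, ρ₁, ρ₂, ρ₃, ρ₄, hS, hρ₃, hall⟩ := hBL t D ϰ hϰ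
  -- the three `η`-thresholds: printed error, `b > max b* (2/√γ_A)`, collar defect
  obtain ⟨η₁, C₁, hη₁pos, hη₁le, hC₁, hE₁⟩ := errTerm_pFun_le ρ₁ ρ₂ ρ₄ t hS hρ₃ hb₀ hp₀ hσ hc hκ hκσ
  obtain ⟨η₂, hη₂pos, hη₂le, hη₂⟩ :=
    exists_le_one_add_log_inv_rpow (lt_trans (by norm_num) hp₀ : 0 < p₀) ((|bstar| + 2 / Real.sqrt γA + 1) / b₀)
  obtain ⟨η₃, hη₃pos, hη₃le, hη₃⟩ := exp_neg_pFun_sq_le_rpow (κ := κ) hγA0 hb₀ (by linarith : 1 / 2 < p₀) hκ.le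
  refine ⟨min η₁ (min η₂ η₃), C₁ + 4 * 8 ^ d, lt_min hη₁pos (lt_min hη₂pos hη₃pos), (min_le_left _ _).trans hη₁le, by positivity, ?_⟩
  intro η hη hηle Λ A K hK hΛne hAs hγA hJc hM hM₂ s I J a hI hJI hJΛ hAc
  have hηη₁ : η ≤ η₁ := hηle.trans (min_le_left _ _)
  have hηη₂ : η ≤ η₂ := hηle.trans ((min_le_right _ _).trans (min_le_left _ _))
  have hηη₃ : η ≤ η₃ := hηle.trans ((min_le_right _ _).trans (min_le_right _ _))
  set b : ℝ := B10.pFun b₀ p₀ η with hbdef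
  -- the threshold bounds
  have hbig : |bstar| + 2 / Real.sqrt γA + 1 ≤ b := by
    have hMM := hη₂ η hη hηη₂
    have h1 := mul_le_mul_of_nonneg_left hMM hb₀.le
    rw [mul_div_cancel₀ _ hb₀.ne'] at h1
    rw [hbdef]
    unfold B10.pFun
    exact h1
  have hsq0 : 0 < Real.sqrt γA := Real.sqrt_pos.mpr hγA0
  have h2s : 0 ≤ 2 / Real.sqrt γA := by positivity
  have hbstar : bstar < b := by linarith [le_abs_self bstar]
  have hbpos : 0 < b := by linarith [abs_nonneg bstar]
  have hbc : 4 * γA⁻¹ ≤ b ^ 2 := by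
    have h1 : 2 / Real.sqrt γA ≤ b := by linarith [abs_nonneg bstar]
    have h2 : (2 / Real.sqrt γA) ^ 2 = 4 * γA⁻¹ := by
      rw [div_pow, Real.sq_sqrt hγA0.le]; ring
    rw [← h2]
    exact pow_le_pow_left₀ h2s h1 2
  -- THE COLLAR: pad, region, member
  set R : ℤ := ⌊b ^ 2⌋ with hR
  set pad : Finset (B1Eq324BenfattoLemma.Site d) :=
    J.biUnion fun x => Fintype.piFinset fun i => Finset.Icc (x i - R) (x i + R) with hpad_def
  set Λ' : Finset (B1Eq324BenfattoLemma.Site d) := Λ ∪ (pad \ Λ) with hΛ'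
  have hΛ : Λ ⊆ Λ' := Finset.subset_union_left
  set A' : Matrix Λ' Λ' ℝ := Matrix.of fun e e' =>
    if h : (e : B1Eq324BenfattoLemma.Site d) ∈ Λ ∧ (e' : B1Eq324BenfattoLemma.Site d) ∈ Λ then A ⟨e, h.1⟩ ⟨e', h.2⟩
    else if e = e' then γA else 0 with hA'
  have hAA : ∀ (e e' : Λ') (he : (e : B1Eq324BenfattoLemma.Site d) ∈ Λ) (he' : (e' : B1Eq324BenfattoLemma.Site d) ∈ Λ),
      A' e e' = A ⟨e, he⟩ ⟨e', he'⟩ := fun e e' he he' => by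
    rw [hA', Matrix.of_apply, dif_pos ⟨he, he'⟩]
  have hcross₁ : ∀ e e' : Λ', (e : B1Eq324BenfattoLemma.Site d) ∈ Λ → (e' : B1Eq324BenfattoLemma.Site d) ∉ Λ → A' e e' = 0 :=
    fun e e' he he' => by
      have hne : e ≠ e' := fun h => he' (h ▸ he)
      rw [hA', Matrix.of_apply, dif_neg (fun h => he' h.2), if_neg hne]
  have hcross₂ : ∀ e e' : Λ', (e : B1Eq324BenfattoLemma.Site d) ∉ Λ → (e' : B1Eq324BenfattoLemma.Site d) ∈ Λ → A' e e' = 0 :=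
    fun e e' he he' => by
      have hne : e ≠ e' := fun h => he (h ▸ he')
      rw [hA', Matrix.of_apply, dif_neg (fun h => he h.1), if_neg hne]
  have hdiag : ∀ e e' : Λ', (e : B1Eq324BenfattoLemma.Site d) ∉ Λ → (e' : B1Eq324BenfattoLemma.Site d) ∉ Λ →
      A' e e' = if e = e' then γA else 0 := fun e e' he _ => by
    rw [hA', Matrix.of_apply, dif_neg (fun h => he h.1)]
  -- the collar member's rows
  have hAs' := B1Eq324BenfattoClassCollar.symm_collar (c := γA) hAs hAA hcross₁ hcross₂ hdiag
  have hγA' := B1Eq324BenfattoClassCollar.coercive_collar hΛ hγA le_rfl hAA hcross₁ hcross₂ hdiag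
  have hApd : A.PosDef := posDef_of_coercive hAs hγA0 hγA
  have hA'pd : A'.PosDef := posDef_of_coercive hAs' hγA0 hγA'
  have hJc' : ∀ e : Λ', ∑ e' : Λ', |A' e e'| *
      (Real.cosh (θ * Real.sqrt (∑ j, ((((e : B1Eq324BenfattoLemma.Site d) j : ℝ) - ((e' : B1Eq324BenfattoLemma.Site d) j : ℝ))) ^ 2)) - 1) ≤ Jc := by
    intro e
    have h := B1Eq324BenfattoClassCollar.row_collar_le hΛ
      (fun x y : B1Eq324BenfattoLemma.Site d => Real.cosh (θ * Real.sqrt (∑ j, (((x j : ℝ) - (y j : ℝ))) ^ 2)) - 1) (R := Jc) (w₀ := 0)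
      hJc (fun e _ => by simp) hAA hcross₁ hcross₂ hdiag e
    rwa [mul_zero, max_eq_left hJc0] at h
  have hM' : ∀ e : Λ', ∑ e' : Λ', |A' e e'| *
      (1 + Real.sqrt (∑ j, ((((e : B1Eq324BenfattoLemma.Site d) j : ℝ) - ((e' : B1Eq324BenfattoLemma.Site d) j : ℝ))) ^ 2)) ≤ max M γA := by
    intro e
    have h := B1Eq324BenfattoClassCollar.row_collar_le hΛ
      (fun x y : B1Eq324BenfattoLemma.Site d => 1 + Real.sqrt (∑ j, (((x j : ℝ) - (y j : ℝ))) ^ 2)) (R := M) (w₀ := 1)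
      hM (fun e _ => by simp) hAA hcross₁ hcross₂ hdiag e
    rwa [mul_one, abs_of_pos hγA0] at h
  have hM₂' : ∀ e : Λ', ∑ e' : Λ', |A' e e'| *
      Real.exp (θ / 2 * Real.sqrt (∑ j, ((((e : B1Eq324BenfattoLemma.Site d) j : ℝ) - ((e' : B1Eq324BenfattoLemma.Site d) j : ℝ))) ^ 2)) ≤ max M₂ γA := by
    intro e
    have h := B1Eq324BenfattoClassCollar.row_collar_le hΛ
      (fun x y : B1Eq324BenfattoLemma.Site d => Real.exp (θ / 2 * Real.sqrt (∑ j, (((x j : ℝ) - (y j : ℝ))) ^ 2))) (R := M₂) (w₀ := 1)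
      hM₂ (fun e _ => by simp) hAA hcross₁ hcross₂ hdiag e
    rwa [mul_one, abs_of_pos hγA0] at h
  -- the lemma's pad holds in `Λ'`
  have hpad' : ∀ x ∈ J, ∀ z : B1Eq324BenfattoLemma.Site d, (∀ i, ((|z i - x i| : ℤ) : ℝ) ≤ b ^ 2) → z ∈ Λ' := by
    intro x hx z hz
    have hzpad : z ∈ pad := by
      rw [hpad_def, Finset.mem_biUnion]
      refine ⟨x, hx, Fintype.mem_piFinset.mpr fun i => Finset.mem_Icc.mpr ?_⟩
      have hi : |z i - x i| ≤ R := Int.le_floor.mpr (hz i)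
      constructor <;> linarith [(abs_le.mp hi).1, (abs_le.mp hi).2]
    rw [hΛ', Finset.mem_union, Finset.mem_sdiff]
    by_cases hzΛ : z ∈ Λ
    · exact Or.inl hzΛ
    · exact Or.inr ⟨hzpad, hzΛ⟩
  -- the class Basic Lemma for the collar member
  set K' : B1Eq324BenfattoLemma.Site d → B1Eq324BenfattoLemma.Site d → ℝ := fun x y =>
    if h : x ∈ Λ' ∧ y ∈ Λ' then (A'⁻¹ : Matrix Λ' Λ' ℝ) ⟨x, h.1⟩ ⟨y, h.2⟩ else 0 with hK'def
  have hK' : ∀ x y, K' x y = if h : x ∈ Λ' ∧ y ∈ Λ' then (A'⁻¹ : Matrix Λ' Λ' ℝ) ⟨x, h.1⟩ ⟨y, h.2⟩ else 0 := fun _ _ => rfl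
  obtain ⟨h46, h47⟩ := hall hK' (hΛne.mono hΛ) hAs' hγA' hJc' (fun e => hVu Λ' e) hM' (fun e => hV₂u Λ' e) hM₂' (fun e => hV₄u Λ' e)
    s b hbstar I J hI hJI hpad' a
  have hup' := h46 ∅ (fun _ => 0) (Finset.empty_subset _) (fun c hc => absurd hc (Finset.notMem_empty _))
  rw [condFieldK_empty] at hup'
  -- transfer to `μ_K`
  have hAunit : IsUnit A.det := (Matrix.isUnit_iff_isUnit_det A).mp hApd.isUnit
  have hsum : ∀ x y, K' x y = K x y + (fun x y : B1Eq324BenfattoLemma.Site d => if x = y ∧ x ∈ Λ' ∧ x ∉ Λ then γA⁻¹ else 0) x y :=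
    fun x y => B1Eq324BenfattoClassCollar.kernel_collar_eq_add hΛ hAunit hγA0.ne' hAA hcross₁ hcross₂ hdiag hK hK' x y
  have hK0 : ∀ x y, (x ∉ Λ ∨ y ∉ Λ) → K x y = 0 := by
    intro x y hxy
    rw [hK]
    exact dif_neg fun h => hxy.elim (fun hx => hx h.1) (fun hy => hy h.2)
  have hKP0 : ∀ x y, (x ∉ Λ' \ Λ ∨ y ∉ Λ' \ Λ) →
      (fun x y : B1Eq324BenfattoLemma.Site d => if x = y ∧ x ∈ Λ' ∧ x ∉ Λ then γA⁻¹ else 0) x y = 0 := by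
    intro x y hxy
    simp only
    refine if_neg fun h => ?_
    obtain ⟨rfl, hx', hxΛ⟩ := h
    exact hxy.elim (fun hx => hx (Finset.mem_sdiff.mpr ⟨hx', hxΛ⟩)) (fun hy => hy (Finset.mem_sdiff.mpr ⟨hx', hxΛ⟩))
  have hKPC : ∀ x, (fun x y : B1Eq324BenfattoLemma.Site d => if x = y ∧ x ∈ Λ' ∧ x ∉ Λ then γA⁻¹ else 0) x x ≤ γA⁻¹ := by
    intro x
    simp only
    split_ifs
    · exact le_rfl
    · exact inv_nonneg.mpr hγA0.le
  obtain ⟨hlowK, hupK⟩ := B1Eq324BenfattoClassCollar.sandwich_of_collar_sandwich (isPosSemidefKernel_kernel hK hApd)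
    (isPosSemidefKernel_kernel hK' hA'pd) (B1Eq324BenfattoClassCollar.isPosSemidefKernel_collarDiag (Λ := Λ) (Λ' := Λ') hγA0)
    Finset.disjoint_sdiff hsum hK0 hKP0 (inv_pos.mpr hγA0) hKPC a hJΛ hI hbpos hbc t h47 hup'
  -- the two error pieces at the threshold
  have hI0 : (0 : ℝ) ≤ I.card := Nat.cast_nonneg _
  have hδ0 : 0 ≤ (I.card : ℝ) * (4 * 8 ^ d * Real.exp (-(b ^ 2 / (2 * γA⁻¹)))) :=
    mul_nonneg hI0 (mul_nonneg (mul_nonneg (by norm_num) (pow_nonneg (by norm_num) d)) (Real.exp_pos _).le)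
  have hlow2 : Real.exp (cumulantSum (gaussianFieldOfKernel K) (hamiltonian s D ϰ a J) t -
      ((I.card : ℝ) * errTerm S ρ₁ ρ₂ ρ₃ ρ₄ (coefSup s D a J) b t + (I.card : ℝ) * (4 * 8 ^ d * Real.exp (-(b ^ 2 / (2 * γA⁻¹)))))) ≤
      ∫ z, cutoffBoltzmann (hamiltonian s D ϰ a J) I b z ∂gaussianFieldOfKernel K :=
    le_trans (Real.exp_le_exp.mpr (by linarith)) hlowK
  have hup2 : ∫ z, cutoffBoltzmann (hamiltonian s D ϰ a J) I b z ∂gaussianFieldOfKernel K ≤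
      Real.exp (cumulantSum (gaussianFieldOfKernel K) (hamiltonian s D ϰ a J) t +
        ((I.card : ℝ) * errTerm S ρ₁ ρ₂ ρ₃ ρ₄ (coefSup s D a J) b t + (I.card : ℝ) * (4 * 8 ^ d * Real.exp (-(b ^ 2 / (2 * γA⁻¹)))))) := by
    rw [← add_assoc]; exact hupK
  obtain ⟨hpos, habs⟩ := pos_and_abs_log_sub_le_of_sandwich hlow2 hup2
  refine ⟨hpos, habs.trans ?_⟩
  have herr : errTerm S ρ₁ ρ₂ ρ₃ ρ₄ (coefSup s D a J) b t ≤ C₁ * η ^ κ :=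
    hE₁ η (coefSup s D a J) hη hηη₁ (coefSup_nonneg s D a J) hAc
  have hdef : 4 * 8 ^ d * Real.exp (-(b ^ 2 / (2 * γA⁻¹))) ≤ 4 * 8 ^ d * η ^ κ :=
    mul_le_mul_of_nonneg_left (hη₃ η hη hηη₃) (mul_nonneg (by norm_num) (pow_nonneg (by norm_num) d))
  have h1 := mul_le_mul_of_nonneg_left herr hI0
  have h2 := mul_le_mul_of_nonneg_left hdef hI0
  calc (I.card : ℝ) * errTerm S ρ₁ ρ₂ ρ₃ ρ₄ (coefSup s D a J) b t + (I.card : ℝ) * (4 * 8 ^ d * Real.exp (-(b ^ 2 / (2 * γA⁻¹))))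
      ≤ (I.card : ℝ) * (C₁ * η ^ κ) + (I.card : ℝ) * (4 * 8 ^ d * η ^ κ) := add_le_add h1 h2
    _ = (C₁ + 4 * 8 ^ d) * η ^ κ * I.card := by ring


/-! ## §4  Unconditional: composing with seat n08-c's `classBasicLemma_signed` and the lattice growth rows of `…ClassEntryRows` -/

/-- ★★★ **(3.24) FOR THE GAUSSIAN FIELD OF A CLASS KERNEL, UNCONDITIONAL (padded form)**: `eq324_of_classSigned` ∘
`…KernelSect5ClassBasicLemma.classBasicLemma_signed` — for `0 < d` and class constants `2 ≤ γ_A`, `0 ≤ J_c < γ_A`, `θ > 0`, `V, M, V₂, M₂, V₄ ≥ 0`.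
[cite: Balaban1982Higgs1, (3.24) p.616; BenfattoEtAl1978, Lemma (4.5)–(4.7) p.152; Balaban1985BackgroundPropagators, Sect. E p.428 (class form; ours)] -/
theorem eq324_kernel (hd : 0 < d) (hγA2 : 2 ≤ γA) (hJc0 : 0 ≤ Jc) (hJcγ : Jc < γA) (hθ : 0 < θ)
    (hV0 : 0 ≤ V) (hM0 : 0 ≤ M) (hV₂0 : 0 ≤ V₂) (hM₂0 : 0 ≤ M₂) (hV₄0 : 0 ≤ V₄)
    (t D : ℕ) {ϰ : ℝ} (hϰ : 0 < ϰ) {b₀ p₀ σ c κ : ℝ} (hb₀ : 0 < b₀) (hp₀ : 2 / 3 < p₀) (hσ : 0 < σ) (hc : 0 ≤ c) (hκ : 0 < κ)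
    (hκσ : κ < σ * (t + 1)) :
    ∃ η₀ C : ℝ, 0 < η₀ ∧ η₀ ≤ 1 ∧ 0 ≤ C ∧ ∀ η : ℝ, 0 < η → η ≤ η₀ →
      ∀ {Λ : Finset (B1Eq324BenfattoLemma.Site d)} {A : Matrix Λ Λ ℝ} {K : B1Eq324BenfattoLemma.Site d → B1Eq324BenfattoLemma.Site d → ℝ},
        (∀ x y, K x y = if h : x ∈ Λ ∧ y ∈ Λ then (A⁻¹ : Matrix Λ Λ ℝ) ⟨x, h.1⟩ ⟨y, h.2⟩ else 0) → Λ.Nonempty →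
        (∀ e e', A e e' = A e' e) → (∀ x : Λ → ℝ, γA * ∑ e, x e ^ 2 ≤ ∑ e, ∑ e', A e e' * x e * x e') →
        (∀ e : Λ, ∑ e' : Λ, |A e e'| * (Real.cosh (θ * Real.sqrt (∑ j, ((((e : B1Eq324BenfattoLemma.Site d) j : ℝ) - ((e' : B1Eq324BenfattoLemma.Site d) j : ℝ))) ^ 2)) - 1) ≤ Jc) →
        (∀ e : Λ, ∑ e' : Λ, Real.exp (-(θ * Real.sqrt (∑ j, ((((e : B1Eq324BenfattoLemma.Site d) j : ℝ) - ((e' : B1Eq324BenfattoLemma.Site d) j : ℝ))) ^ 2))) *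
          (1 + Real.sqrt (∑ j, ((((e : B1Eq324BenfattoLemma.Site d) j : ℝ) - ((e' : B1Eq324BenfattoLemma.Site d) j : ℝ))) ^ 2)) ≤ V) →
        (∀ e : Λ, ∑ e' : Λ, |A e e'| * (1 + Real.sqrt (∑ j, ((((e : B1Eq324BenfattoLemma.Site d) j : ℝ) - ((e' : B1Eq324BenfattoLemma.Site d) j : ℝ))) ^ 2)) ≤ M) →
        (∀ e : Λ, ∑ e' : Λ, Real.exp (-(θ / 2 * Real.sqrt (∑ j, ((((e : B1Eq324BenfattoLemma.Site d) j : ℝ) - ((e' : B1Eq324BenfattoLemma.Site d) j : ℝ))) ^ 2))) ≤ V₂) →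
        (∀ e : Λ, ∑ e' : Λ, |A e e'| * Real.exp (θ / 2 * Real.sqrt (∑ j, ((((e : B1Eq324BenfattoLemma.Site d) j : ℝ) - ((e' : B1Eq324BenfattoLemma.Site d) j : ℝ))) ^ 2)) ≤ M₂) →
        (∀ e : Λ, ∑ e' : Λ, Real.exp (-(θ / 4 * Real.sqrt (∑ j, ((((e : B1Eq324BenfattoLemma.Site d) j : ℝ) - ((e' : B1Eq324BenfattoLemma.Site d) j : ℝ))) ^ 2))) *
          (1 + Real.sqrt (∑ j, ((((e : B1Eq324BenfattoLemma.Site d) j : ℝ) - ((e' : B1Eq324BenfattoLemma.Site d) j : ℝ))) ^ 2)) ≤ V₄) →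
        ∀ (s : ℕ) (I J : Finset (B1Eq324BenfattoLemma.Site d)) (a : Coef d), I.Nonempty → J ⊆ I →
          (∀ x ∈ J, ∀ z : B1Eq324BenfattoLemma.Site d, (∀ i, ((|z i - x i| : ℤ) : ℝ) ≤ B10.pFun b₀ p₀ η ^ 2) → z ∈ Λ) →
          coefSup s D a J ≤ c * η ^ σ →
          0 < ∫ z, cutoffBoltzmann (hamiltonian s D ϰ a J) I (B10.pFun b₀ p₀ η) z ∂gaussianFieldOfKernel K ∧
            |Real.log (∫ z, cutoffBoltzmann (hamiltonian s D ϰ a J) I (B10.pFun b₀ p₀ η) z ∂gaussianFieldOfKernel K) -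
                cumulantSum (gaussianFieldOfKernel K) (hamiltonian s D ϰ a J) t| ≤ C * η ^ κ * I.card :=
  eq324_of_classSigned (B1Eq324BenfattoKernelSect5ClassBasicLemma.classBasicLemma_signed hd hγA2 hJc0 hJcγ hθ hV0 hM0 hV₂0 hM₂0 hV₄0)
    t D hϰ hb₀ hp₀ hσ hc hκ hκσ

/-- ★★★★ **(3.24) FOR THE GAUSSIAN FIELD OF A CLASS KERNEL, UNCONDITIONAL, NO PAD, ROWS FROM THE LATTICE**: for `0 < d` and constants `2 ≤ γ_A`,
`0 ≤ J_c < γ_A`, `θ > 0`, `M, M₂ ≥ 0`, every `t D`, `ϰ > 0`, `b₀ > 0`, `p₀ > 2/3`, `σ > 0`, `c ≥ 0`, `0 < κ < σ(t+1)`: there are `η₀ ∈ (0,1]`, `C ≥ 0` such that for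
all `η ≤ η₀`, every member `(Λ, A, K)` — `Λ ≠ ∅`, `A` symmetric and `γ_A`-coercive, with the Combes–Thomas row `J_c` at rate `θ` and the absolute rows
`M`, `M₂` (NOTHING ELSE: the growth rows come from `…ClassEntryRows`) — and every `(s, I, J, a)` with `I ≠ ∅`, `J ⊆ I`, `J ⊆ Λ`, `coefSup ≤ c·η^σ`:
`0 < ∫Π_Δχ̂_{p(η)}e^{H_J}dμ_K ∧ |log ∫Π_Δχ̂_{p(η)}e^{H_J}dμ_K − cumulantSum μ_K H_J t| ≤ C·η^κ·|I|` (`eq324_of_classSigned_noPad` ∘ `classBasicLemma_signed`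
at the collar constants `(V*, max M γ_A, V₂*, max M₂ γ_A, V₄*)`, `V* = (1+2/θ)K_d(θ/2)`, `V₂* = K_d(θ/2)`, `V₄* = (1+8/θ)K_d(θ/8)`).
[cite: Balaban1982Higgs1, (3.24) p.616; BenfattoEtAl1978, Lemma (4.5)–(4.7) p.152; Balaban1985BackgroundPropagators, Sect. E p.428 (class form; collar and rows ours)] -/
theorem eq324_kernel_noPad (hd : 0 < d) {γA Jc θ M M₂ : ℝ} (hγA2 : 2 ≤ γA) (hJc0 : 0 ≤ Jc) (hJcγ : Jc < γA) (hθ : 0 < θ)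
    (hM0 : 0 ≤ M) (hM₂0 : 0 ≤ M₂)
    (t D : ℕ) {ϰ : ℝ} (hϰ : 0 < ϰ) {b₀ p₀ σ c κ : ℝ} (hb₀ : 0 < b₀) (hp₀ : 2 / 3 < p₀) (hσ : 0 < σ) (hc : 0 ≤ c) (hκ : 0 < κ)
    (hκσ : κ < σ * (t + 1)) :
    ∃ η₀ C : ℝ, 0 < η₀ ∧ η₀ ≤ 1 ∧ 0 ≤ C ∧ ∀ η : ℝ, 0 < η → η ≤ η₀ →
      ∀ {Λ : Finset (B1Eq324BenfattoLemma.Site d)} {A : Matrix Λ Λ ℝ} {K : B1Eq324BenfattoLemma.Site d → B1Eq324BenfattoLemma.Site d → ℝ},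
        (∀ x y, K x y = if h : x ∈ Λ ∧ y ∈ Λ then (A⁻¹ : Matrix Λ Λ ℝ) ⟨x, h.1⟩ ⟨y, h.2⟩ else 0) → Λ.Nonempty →
        (∀ e e', A e e' = A e' e) → (∀ x : Λ → ℝ, γA * ∑ e, x e ^ 2 ≤ ∑ e, ∑ e', A e e' * x e * x e') →
        (∀ e : Λ, ∑ e' : Λ, |A e e'| * (Real.cosh (θ * Real.sqrt (∑ j, ((((e : B1Eq324BenfattoLemma.Site d) j : ℝ) - ((e' : B1Eq324BenfattoLemma.Site d) j : ℝ))) ^ 2)) - 1) ≤ Jc) →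
        (∀ e : Λ, ∑ e' : Λ, |A e e'| * (1 + Real.sqrt (∑ j, ((((e : B1Eq324BenfattoLemma.Site d) j : ℝ) - ((e' : B1Eq324BenfattoLemma.Site d) j : ℝ))) ^ 2)) ≤ M) →
        (∀ e : Λ, ∑ e' : Λ, |A e e'| * Real.exp (θ / 2 * Real.sqrt (∑ j, ((((e : B1Eq324BenfattoLemma.Site d) j : ℝ) - ((e' : B1Eq324BenfattoLemma.Site d) j : ℝ))) ^ 2)) ≤ M₂) →
        ∀ (s : ℕ) (I J : Finset (B1Eq324BenfattoLemma.Site d)) (a : Coef d), I.Nonempty → J ⊆ I → J ⊆ Λ →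
          coefSup s D a J ≤ c * η ^ σ →
          0 < ∫ z, cutoffBoltzmann (hamiltonian s D ϰ a J) I (B10.pFun b₀ p₀ η) z ∂gaussianFieldOfKernel K ∧
            |Real.log (∫ z, cutoffBoltzmann (hamiltonian s D ϰ a J) I (B10.pFun b₀ p₀ η) z ∂gaussianFieldOfKernel K) -
                cumulantSum (gaussianFieldOfKernel K) (hamiltonian s D ϰ a J) t| ≤ C * η ^ κ * I.card := by
  classical
  have hγA0 : 0 < γA := by linarith
  -- the lattice growth constants are non-negative: each dominates a row at the one-site window `{0}`
  have hone : ((0 : B1Eq324BenfattoLemma.Site d)) ∈ ({0} : Finset (B1Eq324BenfattoLemma.Site d)) := Finset.mem_singleton_self _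
  have hrow_nonneg : ∀ (w : B1Eq324BenfattoLemma.Site d → B1Eq324BenfattoLemma.Site d → ℝ), (∀ x y, 0 ≤ w x y) →
      ∀ {B : ℝ}, (∑ e' : ({0} : Finset (B1Eq324BenfattoLemma.Site d)), w (0 : B1Eq324BenfattoLemma.Site d) e' ≤ B) → 0 ≤ B :=
    fun w hw B hB => le_trans (Finset.sum_nonneg fun e' _ => hw _ _) hB
  have hV0 := hrow_nonneg (fun x y => Real.exp (-(θ * Real.sqrt (∑ j, (((x j : ℝ) - (y j : ℝ))) ^ 2))) *
      (1 + Real.sqrt (∑ j, (((x j : ℝ) - (y j : ℝ))) ^ 2))) (fun x y => by positivity)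
    (B1Eq324BenfattoClassEntryRows.classRow_V_le hθ ⟨0, hone⟩)
  have hV₂0 := hrow_nonneg (fun x y => Real.exp (-(θ / 2 * Real.sqrt (∑ j, (((x j : ℝ) - (y j : ℝ))) ^ 2)))) (fun x y => by positivity)
    (B1Eq324BenfattoClassEntryRows.classRow_V₂_le hθ ⟨0, hone⟩)
  have hV₄0 := hrow_nonneg (fun x y => Real.exp (-(θ / 4 * Real.sqrt (∑ j, (((x j : ℝ) - (y j : ℝ))) ^ 2))) *
      (1 + Real.sqrt (∑ j, (((x j : ℝ) - (y j : ℝ))) ^ 2))) (fun x y => by positivity)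
    (B1Eq324BenfattoClassEntryRows.classRow_V₄_le hθ ⟨0, hone⟩)
  exact eq324_of_classSigned_noPad hγA0 hJc0
    (B1Eq324BenfattoKernelSect5ClassBasicLemma.classBasicLemma_signed hd hγA2 hJc0 hJcγ hθ hV0 (le_max_of_le_left hM0) hV₂0
      (le_max_of_le_left hM₂0) hV₄0)
    (fun Λ₀ e => B1Eq324BenfattoClassEntryRows.classRow_V_le hθ e) (fun Λ₀ e => B1Eq324BenfattoClassEntryRows.classRow_V₂_le hθ e)
    (fun Λ₀ e => B1Eq324BenfattoClassEntryRows.classRow_V₄_le hθ e) t D hϰ hb₀ hp₀ hσ hc hκ hκσ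

/-- ★★★ **d = 3 ∕ B1's instance — `t = n̄ = 6`, coefficients `∝ η^{1/2}`, `κ = 13/4 > 3`, NO PAD**: «e.g. n > 6» (B1 p.616), «up to the sixth order»
([Balaban1985UV3] p.261), for the Gaussian field of every class member. [cite: Balaban1982Higgs1, (3.24) p.616; Balaban1985UV3, p.261 (class form; ours)] -/
theorem eq324_kernel_noPad_seven (hd : 0 < d) {γA Jc θ M M₂ : ℝ} (hγA2 : 2 ≤ γA) (hJc0 : 0 ≤ Jc) (hJcγ : Jc < γA) (hθ : 0 < θ)
    (hM0 : 0 ≤ M) (hM₂0 : 0 ≤ M₂)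
    (D : ℕ) {ϰ : ℝ} (hϰ : 0 < ϰ) {b₀ p₀ c : ℝ} (hb₀ : 0 < b₀) (hp₀ : 2 / 3 < p₀) (hc : 0 ≤ c) :
    ∃ η₀ C : ℝ, 0 < η₀ ∧ η₀ ≤ 1 ∧ 0 ≤ C ∧ ∀ η : ℝ, 0 < η → η ≤ η₀ →
      ∀ {Λ : Finset (B1Eq324BenfattoLemma.Site d)} {A : Matrix Λ Λ ℝ} {K : B1Eq324BenfattoLemma.Site d → B1Eq324BenfattoLemma.Site d → ℝ},
        (∀ x y, K x y = if h : x ∈ Λ ∧ y ∈ Λ then (A⁻¹ : Matrix Λ Λ ℝ) ⟨x, h.1⟩ ⟨y, h.2⟩ else 0) → Λ.Nonempty →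
        (∀ e e', A e e' = A e' e) → (∀ x : Λ → ℝ, γA * ∑ e, x e ^ 2 ≤ ∑ e, ∑ e', A e e' * x e * x e') →
        (∀ e : Λ, ∑ e' : Λ, |A e e'| * (Real.cosh (θ * Real.sqrt (∑ j, ((((e : B1Eq324BenfattoLemma.Site d) j : ℝ) - ((e' : B1Eq324BenfattoLemma.Site d) j : ℝ))) ^ 2)) - 1) ≤ Jc) →
        (∀ e : Λ, ∑ e' : Λ, |A e e'| * (1 + Real.sqrt (∑ j, ((((e : B1Eq324BenfattoLemma.Site d) j : ℝ) - ((e' : B1Eq324BenfattoLemma.Site d) j : ℝ))) ^ 2)) ≤ M) →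
        (∀ e : Λ, ∑ e' : Λ, |A e e'| * Real.exp (θ / 2 * Real.sqrt (∑ j, ((((e : B1Eq324BenfattoLemma.Site d) j : ℝ) - ((e' : B1Eq324BenfattoLemma.Site d) j : ℝ))) ^ 2)) ≤ M₂) →
        ∀ (s : ℕ) (I J : Finset (B1Eq324BenfattoLemma.Site d)) (a : Coef d), I.Nonempty → J ⊆ I → J ⊆ Λ →
          coefSup s D a J ≤ c * η ^ (1 / 2 : ℝ) →
          0 < ∫ z, cutoffBoltzmann (hamiltonian s D ϰ a J) I (B10.pFun b₀ p₀ η) z ∂gaussianFieldOfKernel K ∧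
            |Real.log (∫ z, cutoffBoltzmann (hamiltonian s D ϰ a J) I (B10.pFun b₀ p₀ η) z ∂gaussianFieldOfKernel K) -
                cumulantSum (gaussianFieldOfKernel K) (hamiltonian s D ϰ a J) 6| ≤ C * η ^ (13 / 4 : ℝ) * I.card :=
  eq324_kernel_noPad hd hγA2 hJc0 hJcγ hθ hM0 hM₂0 6 D hϰ hb₀ hp₀ (by norm_num) hc (by norm_num) (by norm_num)

end Literature.MathematicalPhysics.QuantumFieldTheory.Balaban1983to89.B1Eq324BenfattoKernelEq324

end
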